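import Summits.QuantumFields.BalabanUV.T4Continuum.Support.SmallFieldDomainsMetric
import Summits.QuantumFields.BalabanUV.T4Continuum.Support.SubstrateNorms

/-!
# T⁴ programme, SUBSTRATE — `Support/SmallFieldDomainsRowSum`: the exponential ROW SUM `Σ_{x′} e^{−κ·r(x′)}` FROM A DENSITY COUNT
# `#{x′ : r(x′) ≤ n} ≤ C₀e^{κ₀n}` — the shape in which [Balaban1984PropagatorsII] (2.61) enters the Schur junction of
# `Support/SmallFieldDomainsMetricSchur` — for a general radius function and for the multiscale distance `d_Ω` of a domain sequence

Audit cell `pub-balaban`, SUBSTRATE cell seat p4 (map item P4-6, split off `…MetricSchur` to keep that module free of the `Mathlib`-wide import);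
same namespace as `Support/SmallFieldDomains{,Norms,Metric,MetricSchur}`; the two geometric-series lemmas `sum_pow_le_inv_one_sub` ∕
`inv_one_sub_exp_neg_one` of seat p3's `Support/SubstrateNorms` BY NAME (its `wBound_anchoredSum` is the same argument on `T4OutputRate.Carriers`;
here for a two-point radius on any finite index set, so that neither depends on the other's carrier).

WHAT IS PRINTED (documentation; nothing asserted).  [Balaban1984PropagatorsII] Lemma 2.1 p. 234 (render `…-p012-x2.png`):
*"sup_{y∈𝔅} Σ_{y′∈𝔅} e^{−αδ₀d(y,y′)} ≦ c₁(α), (2.61)"* — obtained there (pp. 232–233, (2.56)–(2.59)) by COUNTING lattice points at given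
multiscale distance.  STATUS OF THE PRINTED CONSTANT: `Literature/…/B6Lemma21Counterexample` (exceeded in `d = 4`), `…/B6Lemma21Repaired`
(`13c₀(½α)^{3d}`); this file keeps every constant a parameter.
WHAT THIS FILE PROVIDES (all `[folklore]`): `sum_exp_neg_le_of_density` — for `r ≥ 0` on a finite `S` with `#{i ∈ S : r i ≤ n} ≤ C₀e^{κ₀n}` (all
`n : ℕ`, `κ₀ ≥ 0`) and `κ ≥ κ₀ + 1`: `Σ_{i∈S} e^{−κ·r i} ≤ C₀·e^{κ₀}·e/(e − 1)` (floor shells, shell `n` counted at radius `n + 1`, geometric tail);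
`sum_exp_neg_msDistΩ_le` — the same read on `r = d_Ω(x, ·)`; and the ONE-SCALE case PROVED: `sum_pow_natAbs_le` (`Σ_{n∈T} q^{|n|} ≤ (1+q)/(1−q)`,
`T ⊆ ℤ` finite), `sum_exp_neg_l1_le` (`Σ_{x′∈S} e^{−κℓ¹(x′−x)} ≤ c₀(κ)^d`, `c₀(κ) = (1+e^{−κ})/(1−e^{−κ})`) and `sum_exp_neg_msDistΩ_constSeq_le`
(on the trivial sequence, where `d_Ω = (s k)⁻¹ℓ¹`: `≤ c₀(κ/s k)^d`).  And the (2.63)-SHAPE COMPOSITION (`n = 2`; [B6] p. 232 «preserved under the composition»): triangle inequality + a row sum at the rate `αδ`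
⇒ the composed exponential majorant decays at the rate `(1−α)δ` (`sum_exp_mul_exp_le_of_rowSum`, `sum_exp_mul_exp_msDistΩ_le`; the abstract-carrier
counterpart is `Literature/…/B6Lemma21Repaired.ineq263With_of_261With`).  The MULTI-LAYER count (how many points of each layer lie within multiscale
distance `n`) is region geometry + [B6] (2.56)–(2.59) and is NOT proved here.
HONEST FRAMING (T4-DAG p. 1).  Real analysis on finite sums; no configuration, no estimate of any NE row; spine 0/9 unchanged; NOT infinite volume,
NOT a mass gap, NOT Clay.  HONEST DEPENDENCY: continuum YM on T⁴ ⇐ BetaPertH ∧ nine spine estimates (0/9 proved); BetaPertH ⇐ (D1) ∧ (D4) ∧ CAP+tail;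
G-an2-4 gates asym, D1 and NE2/3/4.  No `sorry`.
-/

noncomputable section

open scoped BigOperators

namespace Summit.QuantumFields.BalabanUV.T4Continuum.SmallFieldDomains

open Literature.MathematicalPhysics.QuantumFieldTheory.Balaban1983to89.B14DomainGeom

variable {d : ℕ}

/-! ## The exponential row sum from a density hypothesis -/

section Density
variable {ι : Type*}

open Summit.QuantumFields.BalabanUV.T4Continuum.SubstrateNorms (sum_pow_le_inv_one_sub inv_one_sub_exp_neg_one)

/-- **THE EXPONENTIAL ROW SUM FROM A DENSITY BOUND** (the shape of the (2.61) row sum `Σ_{y′} e^{−αδ₀d(y,y′)} ≦ c₁`, reduced to COUNTING: how many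
points of `S` lie within radius `n` of the row's base point).  For a radius function `r ≥ 0` on a finite set `S` with the growth bound
`#{i ∈ S : r i ≤ n} ≤ C₀·e^{κ₀n}` for every `n : ℕ` (`κ₀ ≥ 0`) and a rate `κ ≥ κ₀ + 1`:  `Σ_{i∈S} e^{−κ·r i} ≤ C₀ · e^{κ₀} · e/(e − 1)`
(floor shells `n = ⌊r i⌋`, the shell `n` counted at radius `n + 1`, geometric tail `Σ e^{−n}`; cf. seat p3's `SubstrateNorms.wBound_anchoredSum`,
whose series lemmas are used BY NAME). [folklore] -/
theorem sum_exp_neg_le_of_density (S : Finset ι) (r : ι → ℝ) (hr : ∀ i ∈ S, 0 ≤ r i) {C₀ κ₀ κ : ℝ} (hκ₀ : 0 ≤ κ₀)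
    (hcard : ∀ n : ℕ, ((S.filter (fun i => r i ≤ n)).card : ℝ) ≤ C₀ * Real.exp (κ₀ * n)) (hκ : κ₀ + 1 ≤ κ) :
    ∑ i ∈ S, Real.exp (-(κ * r i)) ≤ C₀ * Real.exp κ₀ * (Real.exp 1 / (Real.exp 1 - 1)) := by
  classical
  set fl : ι → ℕ := fun i => ⌊r i⌋₊ with hfl
  set q : ℝ := Real.exp (-1) with hq
  have hq0 : 0 ≤ q := (Real.exp_pos _).le
  have hq1 : q < 1 := Real.exp_lt_one_iff.mpr (by norm_num)
  -- (a) termwise: `e^{−κ r i} ≤ e^{−κ n_i}`, `n_i = ⌊r i⌋`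
  have hterm : ∀ i ∈ S, Real.exp (-(κ * r i)) ≤ Real.exp (-(κ * (fl i : ℝ))) := fun i hi =>
    Real.exp_le_exp.mpr (by
      have h1 : (fl i : ℝ) ≤ r i := Nat.floor_le (hr i hi)
      have hκ1 : 0 ≤ κ := by linarith
      nlinarith)
  -- (b) the fibre of the shell `n` is counted by the density bound at radius `n + 1`
  have hfib : ∀ n : ℕ, ((S.filter (fun i => fl i = n)).card : ℝ) ≤ C₀ * Real.exp (κ₀ * ((n : ℝ) + 1)) := by
    intro n
    have hsub : S.filter (fun i => fl i = n) ⊆ S.filter (fun i => r i ≤ ((n + 1 : ℕ) : ℝ)) := by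
      intro i hi
      rw [Finset.mem_filter] at hi ⊢
      refine ⟨hi.1, ?_⟩
      have h1 : r i < (fl i : ℝ) + 1 := Nat.lt_floor_add_one (r i)
      rw [hi.2] at h1
      push_cast
      exact h1.le
    calc ((S.filter (fun i => fl i = n)).card : ℝ) ≤ ((S.filter (fun i => r i ≤ ((n + 1 : ℕ) : ℝ))).card : ℝ) := by
          exact_mod_cast Finset.card_le_card hsub
      _ ≤ C₀ * Real.exp (κ₀ * ((n + 1 : ℕ) : ℝ)) := hcard (n + 1)
      _ = C₀ * Real.exp (κ₀ * ((n : ℝ) + 1)) := by push_cast; ring_nf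
  -- (c) per shell: `e^{κ₀(n+1)}·e^{−κn} ≤ e^{κ₀}·q^n`
  have hexp : ∀ n : ℕ, Real.exp (κ₀ * ((n : ℝ) + 1)) * Real.exp (-(κ * n)) ≤ Real.exp κ₀ * q ^ n := by
    intro n
    rw [hq, ← Real.exp_nat_mul, ← Real.exp_add, ← Real.exp_add]
    refine Real.exp_le_exp.mpr ?_
    have hn : (0 : ℝ) ≤ n := Nat.cast_nonneg n
    nlinarith
  have hC₀ : 0 ≤ C₀ := by
    have h0 : (0 : ℝ) ≤ ((S.filter (fun i => r i ≤ ((0 : ℕ) : ℝ))).card : ℝ) := Nat.cast_nonneg _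
    exact le_of_mul_le_mul_right (by rw [zero_mul]; exact h0.trans (hcard 0)) (Real.exp_pos _)
  -- (d) assemble through the floor fibration
  have hmaps : ∀ i ∈ S, fl i ∈ S.image fl := fun i hi => Finset.mem_image_of_mem fl hi
  calc ∑ i ∈ S, Real.exp (-(κ * r i)) ≤ ∑ i ∈ S, Real.exp (-(κ * (fl i : ℝ))) := Finset.sum_le_sum hterm
    _ = ∑ n ∈ S.image fl, ∑ i ∈ S.filter (fun i => fl i = n), Real.exp (-(κ * (n : ℝ))) :=
        (Finset.sum_fiberwise_of_maps_to' hmaps (fun n : ℕ => Real.exp (-(κ * (n : ℝ))))).symm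
    _ = ∑ n ∈ S.image fl, ((S.filter (fun i => fl i = n)).card : ℝ) * Real.exp (-(κ * (n : ℝ))) := by
        refine Finset.sum_congr rfl fun n _ => ?_
        rw [Finset.sum_const, nsmul_eq_mul]
    _ ≤ ∑ n ∈ S.image fl, C₀ * Real.exp (κ₀ * ((n : ℝ) + 1)) * Real.exp (-(κ * (n : ℝ))) :=
        Finset.sum_le_sum fun n _ => mul_le_mul_of_nonneg_right (hfib n) (Real.exp_pos _).le
    _ = C₀ * ∑ n ∈ S.image fl, Real.exp (κ₀ * ((n : ℝ) + 1)) * Real.exp (-(κ * (n : ℝ))) := by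
        rw [Finset.mul_sum]; exact Finset.sum_congr rfl fun n _ => by ring
    _ ≤ C₀ * ∑ n ∈ S.image fl, Real.exp κ₀ * q ^ n :=
        mul_le_mul_of_nonneg_left (Finset.sum_le_sum fun n _ => hexp n) hC₀
    _ = C₀ * Real.exp κ₀ * ∑ n ∈ S.image fl, q ^ n := by rw [← Finset.mul_sum]; ring
    _ ≤ C₀ * Real.exp κ₀ * (1 - q)⁻¹ :=
        mul_le_mul_of_nonneg_left (sum_pow_le_inv_one_sub _ hq0 hq1) (by positivity)
    _ = C₀ * Real.exp κ₀ * (Real.exp 1 / (Real.exp 1 - 1)) := by rw [hq, inv_one_sub_exp_neg_one]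

/-- The density row sum read on the MULTISCALE DISTANCE of a domain sequence: for a base point `x` and a finite `S`, a count
`#{x′ ∈ S : d_Ω(x, x′) ≤ n} ≤ C₀e^{κ₀n}` gives `Σ_{x′∈S} e^{−κ·d_Ω(x,x′)} ≤ C₀·e^{κ₀}·e/(e−1)` for `κ ≥ κ₀ + 1`. [folklore] -/
theorem sum_exp_neg_msDistΩ_le (s : ℕ → ℝ) (hs : ∀ j, 0 < s j) (k : ℕ) (Ω : ℕ → Set (Pt d)) (x : Pt d) (S : Finset (Pt d))
    {C₀ κ₀ κ : ℝ} (hκ₀ : 0 ≤ κ₀)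
    (hcard : ∀ n : ℕ, ((S.filter (fun x' => msDistΩ s k Ω x x' ≤ n)).card : ℝ) ≤ C₀ * Real.exp (κ₀ * n)) (hκ : κ₀ + 1 ≤ κ) :
    ∑ x' ∈ S, Real.exp (-(κ * msDistΩ s k Ω x x')) ≤ C₀ * Real.exp κ₀ * (Real.exp 1 / (Real.exp 1 - 1)) :=
  sum_exp_neg_le_of_density S (fun x' => msDistΩ s k Ω x x') (fun x' _ => msDistΩ_nonneg s k Ω hs x x') hκ₀ hcard hκ

end Density

/-! ## The one-dimensional and the one-scale lattice row sums (the `c₀(·)` of [B6] (2.58)) -/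

section Lattice

open Literature.MathematicalPhysics.QuantumFieldTheory.Balaban1983to89.B7Prop1Explicit (l1)
open Summit.QuantumFields.BalabanUV.T4Continuum.SubstrateNorms (sum_pow_le_inv_one_sub)

/-- ONE DIMENSION: `Σ_{n ∈ T} q^{|n|} ≤ (1 + q)/(1 − q)` for every finite `T ⊆ ℤ`, `0 ≤ q < 1` (the non-negative part is a partial geometric
series `≤ (1 − q)⁻¹`, the negative part `≤ q·(1 − q)⁻¹`; equality in the limit `T ↑ ℤ` — [B6]'s `c₀ = Σ_{z∈ℤ} e^{−½αδ₀|z|}`). [folklore] -/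
theorem sum_pow_natAbs_le (T : Finset ℤ) {q : ℝ} (hq0 : 0 ≤ q) (hq1 : q < 1) :
    ∑ n ∈ T, q ^ n.natAbs ≤ (1 + q) / (1 - q) := by
  classical
  have h1q : 0 < 1 - q := by linarith
  rw [← Finset.sum_filter_add_sum_filter_not T (fun n : ℤ => 0 ≤ n)]
  -- the non-negative part: `n ↦ |n|` is injective there
  have hpos : ∑ n ∈ T.filter (fun n : ℤ => 0 ≤ n), q ^ n.natAbs ≤ (1 - q)⁻¹ := by
    have hinj : Set.InjOn Int.natAbs ↑(T.filter (fun n : ℤ => 0 ≤ n)) := by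
      intro a ha b hb hab
      simp only [Finset.coe_filter, Set.mem_setOf_eq] at ha hb
      omega
    rw [← Finset.sum_image (f := fun m : ℕ => q ^ m) hinj]
    exact sum_pow_le_inv_one_sub _ hq0 hq1
  -- the negative part: `n ↦ |n| − 1` is injective there and `q^{|n|} = q · q^{|n| − 1}`
  have hneg : ∑ n ∈ T.filter (fun n : ℤ => ¬ 0 ≤ n), q ^ n.natAbs ≤ q * (1 - q)⁻¹ := by
    have hinj : Set.InjOn (fun n : ℤ => n.natAbs - 1) ↑(T.filter (fun n : ℤ => ¬ 0 ≤ n)) := by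
      intro a ha b hb hab
      simp only [Finset.coe_filter, Set.mem_setOf_eq, not_le] at ha hb hab
      omega
    have hterm : ∀ n ∈ T.filter (fun n : ℤ => ¬ 0 ≤ n), q ^ n.natAbs = q * q ^ (n.natAbs - 1) := by
      intro n hn
      simp only [Finset.mem_filter, not_le] at hn
      obtain ⟨m, hm⟩ : ∃ m, n.natAbs = m + 1 := ⟨n.natAbs - 1, by omega⟩
      rw [hm, pow_succ, Nat.add_sub_cancel, mul_comm]
    rw [Finset.sum_congr rfl hterm, ← Finset.mul_sum, ← Finset.sum_image (f := fun m : ℕ => q ^ m) hinj]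
    exact mul_le_mul_of_nonneg_left (sum_pow_le_inv_one_sub _ hq0 hq1) hq0
  calc ∑ n ∈ T.filter (fun n : ℤ => 0 ≤ n), q ^ n.natAbs + ∑ n ∈ T.filter (fun n : ℤ => ¬ 0 ≤ n), q ^ n.natAbs
      ≤ (1 - q)⁻¹ + q * (1 - q)⁻¹ := add_le_add hpos hneg
    _ = (1 + q) / (1 - q) := by field_simp

/-- `e^{−κ·ℓ¹(z)} = Π_i q^{|z_i|}` with `q = e^{−κ}`. [folklore] -/
theorem exp_neg_mul_l1_eq_prod (κ : ℝ) (z : Pt d) :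
    Real.exp (-(κ * (l1 z : ℝ))) = ∏ i, Real.exp (-κ) ^ (z i).natAbs := by
  unfold l1
  push_cast
  rw [Finset.mul_sum, ← Finset.sum_neg_distrib, Real.exp_sum]
  refine Finset.prod_congr rfl fun i _ => ?_
  rw [← Real.exp_nat_mul]; ring_nf

/-- **THE ONE-SCALE LATTICE ROW SUM**: for every finite `S ⊆ ℤ^d`, base point `x` and rate `κ > 0`,
`Σ_{x′∈S} e^{−κ·ℓ¹(x′ − x)} ≤ ((1 + e^{−κ})/(1 − e^{−κ}))^d` — [B6]'s `c₀(κ)^d` (product of `d` one-dimensional sums). [folklore] -/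
theorem sum_exp_neg_l1_le (S : Finset (Pt d)) (x : Pt d) {κ : ℝ} (hκ : 0 < κ) :
    ∑ x' ∈ S, Real.exp (-(κ * (l1 (x' - x) : ℝ))) ≤ ((1 + Real.exp (-κ)) / (1 - Real.exp (-κ))) ^ d := by
  classical
  set q : ℝ := Real.exp (-κ) with hq
  have hq0 : 0 ≤ q := (Real.exp_pos _).le
  have hq1 : q < 1 := Real.exp_lt_one_iff.mpr (by linarith)
  -- translate to the origin
  have hinj : Set.InjOn (fun x' : Pt d => x' - x) ↑S := fun a _ b _ hab => sub_left_injective hab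
  rw [← Finset.sum_image (f := fun z : Pt d => Real.exp (-(κ * (l1 z : ℝ)))) hinj]
  set S' := S.image (fun x' : Pt d => x' - x) with hS'
  -- product form and the coordinate box
  simp only [exp_neg_mul_l1_eq_prod]
  set T : Fin d → Finset ℤ := fun i => S'.image (fun z : Pt d => z i) with hT
  have hsub : S' ⊆ Fintype.piFinset T := by
    intro z hz
    rw [Fintype.mem_piFinset]
    exact fun i => Finset.mem_image_of_mem (fun z : Pt d => z i) hz
  calc ∑ z ∈ S', ∏ i, q ^ (z i).natAbs ≤ ∑ z ∈ Fintype.piFinset T, ∏ i, q ^ (z i).natAbs :=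
        Finset.sum_le_sum_of_subset_of_nonneg hsub fun z _ _ => Finset.prod_nonneg fun i _ => pow_nonneg hq0 _
    _ = ∏ i, ∑ n ∈ T i, q ^ n.natAbs := (Finset.prod_univ_sum T (fun i (n : ℤ) => q ^ n.natAbs)).symm
    _ ≤ ∏ _i : Fin d, (1 + q) / (1 - q) :=
        Finset.prod_le_prod (fun i _ => Finset.sum_nonneg fun n _ => pow_nonneg hq0 _) fun i _ => sum_pow_natAbs_le (T i) hq0 hq1
    _ = ((1 + q) / (1 - q)) ^ d := by rw [Finset.prod_const, Finset.card_univ, Fintype.card_fin]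

/-- **THE GLOBAL (ONE-SCALE) CASE OF (2.61) FOR THE CELL'S `d_Ω`**: on the trivial domain sequence `constSeq k` (every point of index `k`,
`d_Ω = (s k)⁻¹·ℓ¹` by `msDistΩ_constSeq`), `Σ_{x′∈S} e^{−κ·d_Ω(x,x′)} ≤ c₀(κ/s k)^d` for every finite `S` — a PROVED instance of the row-sum
hypothesis shape of `SmallFieldDomainsMetricSchur` (the multi-layer count stays a hypothesis there). [folklore] -/
theorem sum_exp_neg_msDistΩ_constSeq_le (s : ℕ → ℝ) (hs : ∀ j, 0 < s j) (k : ℕ) (S : Finset (Pt d)) (x : Pt d) {κ : ℝ} (hκ : 0 < κ) :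
    ∑ x' ∈ S, Real.exp (-(κ * msDistΩ s k (constSeq k) x x'))
      ≤ ((1 + Real.exp (-(κ / s k))) / (1 - Real.exp (-(κ / s k)))) ^ d := by
  have hκ' : 0 < κ / s k := div_pos hκ (hs k)
  have e1 : ∀ x', κ * msDistΩ s k (constSeq k) x x' = κ / s k * (l1 (x' - x) : ℝ) := fun x' => by
    rw [msDistΩ_constSeq s k hs x x', div_eq_mul_inv]; ring
  simp only [e1]
  exact sum_exp_neg_l1_le S x hκ'

end Lattice

/-! ## Composition of two decaying majorants ((2.63)-shape, `n = 2`) -/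

section Composition
variable {ι : Type*}

/-- **(2.63)-SHAPE COMPOSITION** ([B6] p. 232 «the point is that this property is preserved under the composition of operators possessing it»):
for a distance-like `dist ≥ 0` with the TRIANGLE INEQUALITY and a (2.61)-shape row sum at the rate `α·δ` (`0 ≤ α ≤ 1`, `δ ≥ 0`), the composed
majorant decays at the rate `(1 − α)·δ`: `Σ_{x′∈S} e^{−δ·dist x x′}·e^{−δ·dist x′ x″} ≤ c₁·e^{−(1−α)δ·dist x x″}`. [folklore] -/
theorem sum_exp_mul_exp_le_of_rowSum (S : Finset ι) {dist : ι → ι → ℝ} (hdist : ∀ a b, 0 ≤ dist a b)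
    (htri : ∀ a b c, dist a c ≤ dist a b + dist b c) {δ α c₁ : ℝ} (hδ : 0 ≤ δ) (hα0 : 0 ≤ α) (hα1 : α ≤ 1) {x x'' : ι}
    (hrow : ∑ x' ∈ S, Real.exp (-(α * δ * dist x x')) ≤ c₁) :
    ∑ x' ∈ S, Real.exp (-(δ * dist x x')) * Real.exp (-(δ * dist x' x''))
      ≤ c₁ * Real.exp (-((1 - α) * δ * dist x x'')) := by
  have hterm : ∀ x' ∈ S, Real.exp (-(δ * dist x x')) * Real.exp (-(δ * dist x' x''))
      ≤ Real.exp (-(α * δ * dist x x')) * Real.exp (-((1 - α) * δ * dist x x'')) := by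
    intro x' _
    rw [← Real.exp_add, ← Real.exp_add]
    refine Real.exp_le_exp.mpr ?_
    have h1 := htri x x' x''
    have h2 := hdist x' x''
    have h3 := hdist x x'
    have h4 : 0 ≤ (1 - α) * δ := mul_nonneg (by linarith) hδ
    have h5 : 0 ≤ α * δ * dist x' x'' := by positivity
    nlinarith
  calc ∑ x' ∈ S, Real.exp (-(δ * dist x x')) * Real.exp (-(δ * dist x' x''))
      ≤ ∑ x' ∈ S, Real.exp (-(α * δ * dist x x')) * Real.exp (-((1 - α) * δ * dist x x'')) := Finset.sum_le_sum hterm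
    _ = (∑ x' ∈ S, Real.exp (-(α * δ * dist x x'))) * Real.exp (-((1 - α) * δ * dist x x'')) := by rw [Finset.sum_mul]
    _ ≤ c₁ * Real.exp (-((1 - α) * δ * dist x x'')) := mul_le_mul_of_nonneg_right hrow (Real.exp_pos _).le

/-- The composition bound read on the multiscale distance `d_Ω` of a domain sequence (triangle inequality `msDistΩ_triangle`, `d_Ω ≥ 0`).
[folklore] -/
theorem sum_exp_mul_exp_msDistΩ_le (s : ℕ → ℝ) (hs : ∀ j, 0 < s j) (k : ℕ) (Ω : ℕ → Set (Pt d)) (S : Finset (Pt d))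
    {δ α c₁ : ℝ} (hδ : 0 ≤ δ) (hα0 : 0 ≤ α) (hα1 : α ≤ 1) {x x'' : Pt d}
    (hrow : ∑ x' ∈ S, Real.exp (-(α * δ * msDistΩ s k Ω x x')) ≤ c₁) :
    ∑ x' ∈ S, Real.exp (-(δ * msDistΩ s k Ω x x')) * Real.exp (-(δ * msDistΩ s k Ω x' x''))
      ≤ c₁ * Real.exp (-((1 - α) * δ * msDistΩ s k Ω x x'')) :=
  sum_exp_mul_exp_le_of_rowSum S (msDistΩ_nonneg s k Ω hs) (msDistΩ_triangle s k Ω hs) hδ hα0 hα1 hrow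

end Composition

end Summit.QuantumFields.BalabanUV.T4Continuum.SmallFieldDomains

end
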